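import Summits.AtomisticToContinuum.HydrodynamicLimit.Theorems.CollisionIsometryCLTCollisionalTransferLocalityDefsE
import Summits.AtomisticToContinuum.HydrodynamicLimit.Theorems.CollisionIsometryCLTCollisionalTransferLocalityWeightedKineticRelaxationDilute
import Summits.AtomisticToContinuum.HydrodynamicLimit.Theorems.CollisionIsometryCLTCollisionalTransferLocalityRhsEnvelope
import HarnessLib

/-!
# The Lipschitz-in-time envelope of the value `RhsA + KfunA` along a good, dilute orbit
(registered stub `stub_envelopeA`, [EnvA] of skeleton v18, line `hemisphere-affine-slaving`,
crux `CollisionalTransferLocality`, stmt-AtomisticToContinuum-9518)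

The v18 reshape of the momentum engine states the marked Campbell law at a FIXED time for even rank-2
marks with a general matrix weight `A` (vocabulary `…DefsE`: `trW`, `kinWA`, `RhsA`, `KfunA`,
`SmoothMatrixOn`); the sup over `τ ≤ t` is recovered on a time grid, which needs THIS deterministic
input: along a GOOD orbit that stays dilute (`ρ̄σ³ ≤ η₁` on `[0, t] × 𝕋³`) under the energy level
`(N+1)⁻¹ E_kin ≤ E₀`, the value `τ ↦ (RhsA(τ), KfunA(τ))` is Lipschitz:
`|RhsA(τ') − RhsA(τ)| + |KfunA(τ') − KfunA(τ)| ≤ L (τ' − τ)`, `L = 60 C_A K η₁ E₀`.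

Proof (elementary). Pointwise in `x`: `p_c = pkin · (Z(ρ̄σ³) − 1)` (`RhsEnvelope.pcoll_eq_pkin_mul`),
`0 ≤ pkin ≤ (2/3) Ē` (`RhsEnvelope.pkin_nonneg_le`), `|Z − 1| ≤ K ρ̄σ³ ≤ K η₁` on a dilute block,
`|tr A| ≤ 3 C_A`, whence `|tr A · p_c| ≤ 2 C_A K η₁ Ē`; `kinWA · p_c = (2/5)(D̄ : A)(Z − 1)` off the guard
`pkin = 0` (`0` on it), with the crude central-moment bound `|D̄_ab| ≤ 16 Ē` (`|v − ū|² ≤ 2|v|² + 2|ū|²`,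
`ρ̄|ū|² ≤ 2Ē`), whence `|kinWA · p_c| ≤ 58 C_A K η₁ Ē`. In `x`: `∫ₓ Ē = (N+1)⁻¹ E_kin` (`integral_EB`),
conserved along the orbit (`configEnergy_orbit`). In `s`: the weight is first clamped in time through
`projIcc 0 t` (`RhsA(τ)`, `KfunA(τ)` for `τ ≤ t` only read `A` on `[0, t]`), which makes its components
jointly continuous on `ℝ × 𝕋³` (`continuous_comp_projIcc`); the slice functionals are then measurable in
`s` (`measurable_pcoll_block`, `measurable_orbit`) and bounded on `[0, t]`, hence integrable,
`∫_{[0,τ']} − ∫_{[0,τ]} = ∫_{(τ,τ']}` and `|∫_{(τ,τ']} F| ≤ sup |F| · (τ' − τ)`. Folklore; no source is cited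
(Chapman–Cowling 1970 §16.4, Spohn 1991 I §3 are the background for the block fields, on the imported tools).
-/

namespace Summit.AtomisticToContinuum.HydrodynamicLimit.Theorems.HemisphereAffineSlaving

open scoped BigOperators Topology Classical ENNReal InnerProductSpace
open Filter Set Function MeasureTheory

noncomputable section

open Literature.MathematicalPhysics.KineticTheory (T3 V3)

namespace EnvelopeA

open Literature.MathematicalPhysics.KineticTheory (hsCompressibility)
open Literature.Analysis.FluidPDE (configEnergy)

variable {N : ℕ} {φ : ℕ → T3 → ℝ} {w : Cfg N} {x : T3}

/-! ### Pointwise bounds -/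

/-- Crude central-moment bound of the block traceless kinetic stress by the block energy:
`|D̄_ab| ≤ 16 Ē` for a nonnegative kernel (`|v − ū|_a |v − ū|_b ≤ |v − ū|² ≤ 2|v|² + 2|ū|²`,
`ρ̄ |ū|² ≤ 2 Ē`). [folklore] -/
theorem abs_Dst_le_EB (hφ0 : ∀ y, 0 ≤ φ N y) (a b : Fin 3) :
    |Dst φ N w x a b| ≤ 16 * EB φ N w x := by
  have hE0 : 0 ≤ EB φ N w x := EB_nonneg hφ0
  set c : ℝ := ((N + 1 : ℕ) : ℝ)⁻¹ with hc
  have hc0 : 0 ≤ c := by positivity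
  set u : V3 := uB φ N w x with hu
  set T : ℝ := c * ∑ i, φ N ((w i).1 - x) * ‖(w i).2 - u‖ ^ 2 with hT
  have hT0 : 0 ≤ T :=
    mul_nonneg hc0 (Finset.sum_nonneg fun i _ => mul_nonneg (hφ0 _) (sq_nonneg _))
  have hcomp : ∀ i l, |(w i).2 l - u l| ≤ ‖(w i).2 - u‖ := fun i l => by
    rw [← PiLp.sub_apply, ← Real.norm_eq_abs]
    exact PiLp.norm_apply_le _ l
  have hterm : ∀ i l l', |φ N ((w i).1 - x) * (((w i).2 l - u l) * ((w i).2 l' - u l'))| ≤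
      φ N ((w i).1 - x) * ‖(w i).2 - u‖ ^ 2 := fun i l l' => by
    rw [abs_mul, abs_mul, abs_of_nonneg (hφ0 _), sq]
    exact mul_le_mul_of_nonneg_left
      (mul_le_mul (hcomp i l) (hcomp i l') (abs_nonneg _) (norm_nonneg _)) (hφ0 _)
  have hsum : ∀ l l', |c * ∑ i, φ N ((w i).1 - x) *
      (((w i).2 l - u l) * ((w i).2 l' - u l'))| ≤ T := fun l l' => by
    rw [abs_mul, abs_of_nonneg hc0, hT]
    exact mul_le_mul_of_nonneg_left ((Finset.abs_sum_le_sum_abs _ _).trans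
      (Finset.sum_le_sum fun i _ => hterm i l l')) hc0
  -- `T ≤ 8 Ē`
  have hρu : rhoB φ N w x * ‖u‖ ^ 2 ≤ 2 * EB φ N w x := by
    rcases (rhoB_nonneg (w := w) (x := x) hφ0).lt_or_eq with hρ | hρ
    · have h := norm_uB_sq_le (w := w) (x := x) hφ0 hρ
      rw [le_div_iff₀ hρ] at h
      linarith [mul_comm (rhoB φ N w x) (‖u‖ ^ 2)]
    · rw [← hρ, zero_mul]
      exact mul_nonneg zero_le_two hE0
  have hT8 : T ≤ 8 * EB φ N w x := by
    have hpt : ∀ i, φ N ((w i).1 - x) * ‖(w i).2 - u‖ ^ 2 ≤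
        φ N ((w i).1 - x) * (2 * ‖(w i).2‖ ^ 2 + 2 * ‖u‖ ^ 2) := fun i => by
      refine mul_le_mul_of_nonneg_left ?_ (hφ0 _)
      have h1 : ‖(w i).2 - u‖ ^ 2 ≤ (‖(w i).2‖ + ‖u‖) ^ 2 :=
        pow_le_pow_left₀ (norm_nonneg _) (norm_sub_le _ _) 2
      nlinarith [h1, sq_nonneg (‖(w i).2‖ - ‖u‖)]
    have hsplit : ∀ i, φ N ((w i).1 - x) * (2 * ‖(w i).2‖ ^ 2 + 2 * ‖u‖ ^ 2) =
        4 * (φ N ((w i).1 - x) * (‖(w i).2‖ ^ 2 / 2)) + 2 * ‖u‖ ^ 2 * φ N ((w i).1 - x) :=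
      fun i => by ring
    calc T ≤ c * ∑ i, φ N ((w i).1 - x) * (2 * ‖(w i).2‖ ^ 2 + 2 * ‖u‖ ^ 2) :=
          mul_le_mul_of_nonneg_left (Finset.sum_le_sum fun i _ => hpt i) hc0
      _ = 4 * EB φ N w x + 2 * (rhoB φ N w x * ‖u‖ ^ 2) := by
          simp_rw [hsplit, Finset.sum_add_distrib, ← Finset.mul_sum]
          rw [EB_eq, rhoB_eq]
          ring
      _ ≤ 8 * EB φ N w x := by linarith
  rw [Dst_eq]
  refine (abs_sub _ _).trans ?_
  have hdiag : |(if a = b then (∑ l : Fin 3, c *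
      ∑ i, φ N ((w i).1 - x) * ((w i).2 l - u l) ^ 2) / 3 else 0)| ≤ T := by
    split_ifs
    · rw [abs_div, abs_of_pos (by norm_num : (0 : ℝ) < 3), div_le_iff₀ (by norm_num : (0 : ℝ) < 3)]
      refine (Finset.abs_sum_le_sum_abs _ _).trans ?_
      calc ∑ l : Fin 3, |c * ∑ i, φ N ((w i).1 - x) * ((w i).2 l - u l) ^ 2|
          ≤ ∑ _l : Fin 3, T := Finset.sum_le_sum fun l _ => by simpa only [sq] using hsum l l
        _ = T * 3 := by simp [Finset.sum_const]; ring
    · rw [abs_zero]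
      exact hT0
  linarith [hsum a b, hdiag]

/-- `|tr A(s, x)| ≤ 3 C_A` when every component is bounded by `C_A`. [folklore] -/
theorem abs_trW_le {A : ℝ → T3 → Fin 3 → Fin 3 → ℝ} {s : ℝ} {x : T3} {CA : ℝ}
    (hA : ∀ a b, |A s x a b| ≤ CA) : |trW A s x| ≤ 3 * CA := by
  unfold trW
  calc |∑ a, A s x a a| ≤ ∑ a, |A s x a a| := Finset.abs_sum_le_sum_abs _ _
    _ ≤ ∑ _a : Fin 3, CA := Finset.sum_le_sum fun a _ => hA a a
    _ = 3 * CA := by simp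

/-- **Pointwise envelope of the trace part.** On a block with `ρ̄σ³ ≤ η₁ ≤ η_Z`, for
`|Z(η) − 1| ≤ Kη` on `[0, η_Z]` and `|A_ab| ≤ C_A`: `|tr A · p_c(ρ̄, θ̄)| ≤ 2 C_A K η₁ Ē`. [folklore] -/
theorem abs_trW_mul_pcoll_le {σ K ηZ η₁ CA : ℝ} (hσ : 0 < σ) (hK : 0 ≤ K) (hη₁Z : η₁ ≤ ηZ)
    (hZ : ∀ η : ℝ, 0 ≤ η → η ≤ ηZ → |hsCompressibility η - 1| ≤ K * η)
    (hφ0 : ∀ y, 0 ≤ φ N y) {A : ℝ → T3 → Fin 3 → Fin 3 → ℝ} {s : ℝ}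
    (hA : ∀ a b, |A s x a b| ≤ CA) (hhi : rhoB φ N w x * σ ^ 3 ≤ η₁) :
    |trW A s x * pcoll σ (rhoB φ N w x) (thetaB φ N w x)| ≤ 2 * CA * K * η₁ * EB φ N w x := by
  have hE0 : 0 ≤ EB φ N w x := EB_nonneg hφ0
  have hη0 : 0 ≤ rhoB φ N w x * σ ^ 3 := mul_nonneg (rhoB_nonneg hφ0) (pow_nonneg hσ.le 3)
  obtain ⟨hP0, hPE⟩ := RhsEnvelope.pkin_nonneg_le (w := w) (x := x) hφ0
  have hZm : |hsCompressibility (rhoB φ N w x * σ ^ 3) - 1| ≤ K * η₁ :=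
    (hZ _ hη0 (hhi.trans hη₁Z)).trans (mul_le_mul_of_nonneg_left hhi hK)
  have hCA : 0 ≤ CA := (abs_nonneg _).trans (hA 0 0)
  rw [RhsEnvelope.pcoll_eq_pkin_mul, abs_mul, abs_mul, abs_of_nonneg hP0]
  calc |trW A s x| * (pkin φ N w x * |hsCompressibility (rhoB φ N w x * σ ^ 3) - 1|)
      ≤ (3 * CA) * ((2 / 3 * EB φ N w x) * (K * η₁)) :=
        mul_le_mul (abs_trW_le hA) (mul_le_mul hPE hZm (abs_nonneg _)
          (mul_nonneg (by norm_num) hE0)) (mul_nonneg hP0 (abs_nonneg _)) (by positivity)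
    _ = 2 * CA * K * η₁ * EB φ N w x := by ring

/-- **Pointwise envelope of the kinetic-correction part.** On a block with `ρ̄σ³ ≤ η₁ ≤ η_Z`, for
`|Z(η) − 1| ≤ Kη` on `[0, η_Z]` and `|A_ab| ≤ C_A`: `|kinWA · p_c(ρ̄, θ̄)| ≤ 58 C_A K η₁ Ē`
(`kinWA · p_c = (2/5)(D̄ : A)(Z − 1)` off the guard `pkin = 0`, `0` on it; `|D̄_ab| ≤ 16 Ē`). [folklore] -/
theorem abs_kinWA_mul_pcoll_le {σ K ηZ η₁ CA : ℝ} (hσ : 0 < σ) (hK : 0 ≤ K) (hη₁Z : η₁ ≤ ηZ)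
    (hZ : ∀ η : ℝ, 0 ≤ η → η ≤ ηZ → |hsCompressibility η - 1| ≤ K * η)
    (hφ0 : ∀ y, 0 ≤ φ N y) {A : ℝ → T3 → Fin 3 → Fin 3 → ℝ} {s : ℝ}
    (hA : ∀ a b, |A s x a b| ≤ CA) (hhi : rhoB φ N w x * σ ^ 3 ≤ η₁) :
    |kinWA A φ N s w x * pcoll σ (rhoB φ N w x) (thetaB φ N w x)| ≤
      58 * CA * K * η₁ * EB φ N w x := by
  have hE0 : 0 ≤ EB φ N w x := EB_nonneg hφ0
  have hη0 : 0 ≤ rhoB φ N w x * σ ^ 3 := mul_nonneg (rhoB_nonneg hφ0) (pow_nonneg hσ.le 3)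
  have hη₁0 : 0 ≤ η₁ := hη0.trans hhi
  have hZm : |hsCompressibility (rhoB φ N w x * σ ^ 3) - 1| ≤ K * η₁ :=
    (hZ _ hη0 (hhi.trans hη₁Z)).trans (mul_le_mul_of_nonneg_left hhi hK)
  have hCA : 0 ≤ CA := (abs_nonneg _).trans (hA 0 0)
  have hprod : 0 ≤ CA * K * η₁ * EB φ N w x :=
    mul_nonneg (mul_nonneg (mul_nonneg hCA hK) hη₁0) hE0
  have hS : |∑ a, ∑ b, Dst φ N w x a b * A s x a b| ≤ 9 * (16 * EB φ N w x * CA) := by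
    calc |∑ a, ∑ b, Dst φ N w x a b * A s x a b|
        ≤ ∑ a, ∑ b, |Dst φ N w x a b * A s x a b| :=
          (Finset.abs_sum_le_sum_abs _ _).trans (Finset.sum_le_sum fun a _ =>
            Finset.abs_sum_le_sum_abs _ _)
      _ ≤ ∑ _a : Fin 3, ∑ _b : Fin 3, 16 * EB φ N w x * CA := by
          refine Finset.sum_le_sum fun a _ => Finset.sum_le_sum fun b _ => ?_
          rw [abs_mul]
          exact mul_le_mul (abs_Dst_le_EB hφ0 a b) (hA a b) (abs_nonneg _)
            (mul_nonneg (by norm_num) hE0)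
      _ = 9 * (16 * EB φ N w x * CA) := by simp [Finset.sum_const]; ring
  rw [RhsEnvelope.pcoll_eq_pkin_mul]
  unfold kinWA
  set P := pkin φ N w x
  set S := ∑ a, ∑ b, Dst φ N w x a b * A s x a b
  set Zm := hsCompressibility (rhoB φ N w x * σ ^ 3) - 1
  by_cases hP : P = 0
  · rw [hP, div_zero, zero_mul, abs_zero]
    linarith
  · have h : 2 / 5 * S / P * (P * Zm) = 2 / 5 * S * Zm := by
      field_simp
    rw [h, abs_mul, abs_mul, abs_of_pos (by norm_num : (0 : ℝ) < 2 / 5)]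
    calc 2 / 5 * |S| * |Zm| ≤ 2 / 5 * (9 * (16 * EB φ N w x * CA)) * (K * η₁) :=
          mul_le_mul (mul_le_mul_of_nonneg_left hS (by norm_num)) hZm (abs_nonneg _)
            (by positivity)
      _ = (288 / 5) * (CA * K * η₁ * EB φ N w x) := by ring
      _ ≤ 58 * CA * K * η₁ * EB φ N w x := by linarith

/-! ### Integration in `x` -/

/-- `x`-integration of a pointwise envelope by a multiple of the block energy:
`‖∫ₓ f‖ ≤ M ∫ₓ Ē = M (N+1)⁻¹ E_kin` (honest dominating integrand: `Ē` is continuous on the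
compact torus; `integral_EB`). [folklore] -/
theorem norm_integral_le_of_abs_le_EB (hφc : Continuous (φ N)) (hφ1 : ∫ y, φ N y = 1)
    {f : T3 → ℝ} {M : ℝ} (hf : ∀ x, |f x| ≤ M * EB φ N w x) :
    ‖∫ x, f x‖ ≤ M * (((N + 1 : ℕ) : ℝ)⁻¹ * configEnergy w) := by
  have hEint : Integrable (fun x => EB φ N w x) :=
    ((continuous_EB hφc).comp (continuous_const.prodMk continuous_id)).integrable_unitAddTorus
  refine (norm_integral_le_of_norm_le (hEint.const_mul M) (ae_of_all _ fun x => ?_)).trans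
    (le_of_eq ?_)
  · rw [Real.norm_eq_abs]
    exact hf x
  · rw [integral_const_mul, integral_EB hφc hφ1]

/-! ### Measurability of the slice functionals -/

/-- `(z, x) ↦ D̄_ab(z, x)` is measurable for a continuous kernel (finite sums of products of
continuous functions and the measurable junk-guarded `ū`). [folklore] -/
theorem measurable_Dst (hφc : Continuous (φ N)) (a b : Fin 3) :
    Measurable fun p : Cfg N × T3 => Dst φ N p.1 p.2 a b := by
  -- adapted from the proof of `measurable_kineticIntegrand` (file …BlockFields)
  haveI : ∀ i : Fin (N + 1), BorelSpace (T3 × V3) := fun _ => Prod.borelSpace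
  have hU := measurable_uB (N := N) hφc
  simp only [Dst_eq]
  generalize uB φ N = u at hU ⊢
  by_cases hab : a = b
  · simp only [hab, if_true]
    fun_prop
  · simp only [hab, if_false, sub_zero]
    fun_prop

/-- `(z, x) ↦ pkin = ρ̄ θ̄` is measurable for a continuous kernel. [folklore] -/
theorem measurable_pkin (hφc : Continuous (φ N)) :
    Measurable fun p : Cfg N × T3 => pkin φ N p.1 p.2 := by
  haveI : ∀ i : Fin (N + 1), BorelSpace (T3 × V3) := fun _ => Prod.borelSpace
  unfold pkin
  exact (continuous_rhoB hφc).measurable.mul (measurable_thetaB hφc)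

/-- Joint measurability in `(s, z)` of the trace slice functional
`∫ₓ g(s, x) p_c(ρ̄, θ̄)` for a jointly continuous scalar weight `g`. [folklore] -/
theorem measurable_integral_trSlice (σ : ℝ) (hφc : Continuous (φ N)) {g : ℝ × T3 → ℝ}
    (hg : Continuous g) :
    Measurable fun q : ℝ × Cfg N => ∫ x, g (q.1, x) *
      pcoll σ (rhoB φ N q.2 x) (thetaB φ N q.2 x) := by
  -- (compositions are normalised with `Function.comp_def`: unifying `g ∘ f` against the stated
  -- lambda through the block fields is pathologically slow for the elaborator)
  have hwx : Measurable fun r : (ℝ × Cfg N) × T3 => ((r.1.2, r.2) : Cfg N × T3) :=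
    measurable_fst.snd.prodMk measurable_snd
  have hsx : Measurable fun r : (ℝ × Cfg N) × T3 => ((r.1.1, r.2) : ℝ × T3) :=
    measurable_fst.fst.prodMk measurable_snd
  have hgm : Measurable fun r : (ℝ × Cfg N) × T3 => g (r.1.1, r.2) := hg.measurable.comp hsx
  have hpc : Measurable fun r : (ℝ × Cfg N) × T3 =>
      pcoll σ (rhoB φ N r.1.2 r.2) (thetaB φ N r.1.2 r.2) := by
    simpa only [Function.comp_def] using (measurable_pcoll_block σ hφc).comp hwx
  have hm : Measurable fun r : (ℝ × Cfg N) × T3 => g (r.1.1, r.2) *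
      pcoll σ (rhoB φ N r.1.2 r.2) (thetaB φ N r.1.2 r.2) := hgm.mul hpc
  have h := hm.stronglyMeasurable.integral_prod_right' (ν := (volume : Measure T3))
  simpa only using h.measurable

/-- Joint measurability in `(s, z)` of the kinetic-correction slice functional
`∫ₓ (2/5)(D̄ : G(s, x))/pkin · p_c(ρ̄, θ̄)` for a componentwise jointly continuous matrix weight
`G`. [folklore] -/
theorem measurable_integral_kinSlice (σ : ℝ) (hφc : Continuous (φ N))
    {G : ℝ × T3 → Fin 3 → Fin 3 → ℝ} (hG : ∀ a b, Continuous fun r => G r a b) :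
    Measurable fun q : ℝ × Cfg N => ∫ x,
      2 / 5 * (∑ a, ∑ b, Dst φ N q.2 x a b * G (q.1, x) a b) / pkin φ N q.2 x *
        pcoll σ (rhoB φ N q.2 x) (thetaB φ N q.2 x) := by
  have hwx : Measurable fun r : (ℝ × Cfg N) × T3 => ((r.1.2, r.2) : Cfg N × T3) :=
    measurable_fst.snd.prodMk measurable_snd
  have hsx : Measurable fun r : (ℝ × Cfg N) × T3 => ((r.1.1, r.2) : ℝ × T3) :=
    measurable_fst.fst.prodMk measurable_snd
  have hD : ∀ a b, Measurable fun r : (ℝ × Cfg N) × T3 => Dst φ N r.1.2 r.2 a b := fun a b => by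
    simpa only [Function.comp_def] using (measurable_Dst hφc a b).comp hwx
  have hGm : ∀ a b, Measurable fun r : (ℝ × Cfg N) × T3 => G (r.1.1, r.2) a b := fun a b => by
    simpa only [Function.comp_def] using (hG a b).measurable.comp hsx
  have hP : Measurable fun r : (ℝ × Cfg N) × T3 => pkin φ N r.1.2 r.2 := by
    simpa only [Function.comp_def] using (measurable_pkin hφc).comp hwx
  have hpc : Measurable fun r : (ℝ × Cfg N) × T3 =>
      pcoll σ (rhoB φ N r.1.2 r.2) (thetaB φ N r.1.2 r.2) := by
    simpa only [Function.comp_def] using (measurable_pcoll_block σ hφc).comp hwx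
  have hm : Measurable fun r : (ℝ × Cfg N) × T3 =>
      2 / 5 * (∑ a, ∑ b, Dst φ N r.1.2 r.2 a b * G (r.1.1, r.2) a b) / pkin φ N r.1.2 r.2 *
        pcoll σ (rhoB φ N r.1.2 r.2) (thetaB φ N r.1.2 r.2) :=
    ((measurable_const.mul (Finset.measurable_sum _ fun a _ =>
      Finset.measurable_sum _ fun b _ => (hD a b).mul (hGm a b))).div hP).mul hpc
  have h := hm.stronglyMeasurable.integral_prod_right' (ν := (volume : Measure T3))
  simpa only using h.measurable

/-! ### The envelope along a good, dilute orbit for a globally continuous weight -/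

/-- **The Lipschitz envelope for a componentwise jointly continuous, bounded weight.** For `σ > 0`,
`K ≥ 0`, `η₁ ≤ η_Z` with `|Z(η) − 1| ≤ Kη` on `[0, η_Z]`, a continuous nonnegative kernel of mass
one, a GOOD initial datum whose orbit has no block denser than `η₁/σ³` on `[0, t]`, and a matrix
weight `A` with jointly continuous components bounded by `C_A`: for `0 ≤ τ ≤ τ' ≤ t`,
`|RhsA(τ') − RhsA(τ)| + |KfunA(τ') − KfunA(τ)| ≤ 60 C_A K η₁ (N+1)⁻¹ E_kin(z) (τ' − τ)`. [folklore] -/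
theorem lipschitz_of_continuous {σ K ηZ η₁ CA : ℝ} (hσ : 0 < σ) (hK : 0 ≤ K) (hη₁Z : η₁ ≤ ηZ)
    (hZ : ∀ η : ℝ, 0 ≤ η → η ≤ ηZ → |hsCompressibility η - 1| ≤ K * η)
    (Φ : Flows σ) (hφc : Continuous (φ N)) (hφ0 : ∀ y, 0 ≤ φ N y) (hφ1 : ∫ y, φ N y = 1)
    {z : Cfg N} (hz : z ∈ (Φ N).good) {A : ℝ → T3 → Fin 3 → Fin 3 → ℝ}
    (hAc : ∀ a b, Continuous fun q : ℝ × T3 => A q.1 q.2 a b) (hAb : ∀ s x a b, |A s x a b| ≤ CA)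
    {t : ℝ} (hdil : ∀ s ∈ Icc 0 t, ∀ x, rhoB φ N ((Φ N).flow s z) x * σ ^ 3 ≤ η₁)
    {τ τ' : ℝ} (hτ : 0 ≤ τ) (hττ' : τ ≤ τ') (hτ't : τ' ≤ t) :
    |RhsA σ Φ φ A N z τ' - RhsA σ Φ φ A N z τ| + |KfunA σ Φ φ A N z τ' - KfunA σ Φ φ A N z τ| ≤
      60 * CA * K * η₁ * (((N + 1 : ℕ) : ℝ)⁻¹ * configEnergy z) * (τ' - τ) := by
  set e : ℝ := ((N + 1 : ℕ) : ℝ)⁻¹ * configEnergy z with he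
  -- the two slice functionals along the orbit
  set F : ℝ → ℝ := fun s => ∫ x, trW A s x *
    pcoll σ (rhoB φ N ((Φ N).flow s z) x) (thetaB φ N ((Φ N).flow s z) x) with hF
  set G : ℝ → ℝ := fun s => ∫ x, kinWA A φ N s ((Φ N).flow s z) x *
    pcoll σ (rhoB φ N ((Φ N).flow s z) x) (thetaB φ N ((Φ N).flow s z) x) with hG
  -- bounds on `[0, t]` (energy conservation along the orbit)
  have hFb : ∀ s ∈ Icc 0 t, ‖F s‖ ≤ 2 * CA * K * η₁ * e := fun s hs => by
    have h := norm_integral_le_of_abs_le_EB (w := (Φ N).flow s z) hφc hφ1 fun x =>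
      abs_trW_mul_pcoll_le hσ hK hη₁Z hZ hφ0 (hAb s x) (hdil s hs x)
    rwa [configEnergy_orbit Φ hz s] at h
  have hGb : ∀ s ∈ Icc 0 t, ‖G s‖ ≤ 58 * CA * K * η₁ * e := fun s hs => by
    have h := norm_integral_le_of_abs_le_EB (w := (Φ N).flow s z) hφc hφ1 fun x =>
      abs_kinWA_mul_pcoll_le hσ hK hη₁Z hZ hφ0 (hAb s x) (hdil s hs x)
    rwa [configEnergy_orbit Φ hz s] at h
  -- measurability in `s`
  have horb : Measurable fun s : ℝ => (s, (Φ N).flow s z) :=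
    measurable_id.prodMk (measurable_orbit Φ hz)
  have hFm : Measurable F := by
    have hg : Continuous fun r : ℝ × T3 => trW A r.1 r.2 := by
      simp only [trW]
      exact continuous_finsetSum _ fun a _ => hAc a a
    simpa only [hF, Function.comp_def] using (measurable_integral_trSlice σ hφc hg).comp horb
  have hGm : Measurable G := by
    have h := (measurable_integral_kinSlice σ hφc (G := fun r a b => A r.1 r.2 a b) hAc).comp horb
    simpa only [hG, kinWA, Function.comp_def] using h
  -- integrability on `[0, t]`
  have hFi : IntegrableOn F (Icc 0 t) :=
    Measure.integrableOn_of_bounded measure_Icc_lt_top.ne hFm.aestronglyMeasurable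
      ((ae_restrict_mem measurableSet_Icc).mono fun s hs => hFb s hs)
  have hGi : IntegrableOn G (Icc 0 t) :=
    Measure.integrableOn_of_bounded measure_Icc_lt_top.ne hGm.aestronglyMeasurable
      ((ae_restrict_mem measurableSet_Icc).mono fun s hs => hGb s hs)
  -- `∫_{[0,τ']} − ∫_{[0,τ]} = ∫_{(τ,τ']}` and the constant bound on `(τ, τ'] ⊆ [0, t]`
  have hIoc : Ioc τ τ' ⊆ Icc 0 t := fun s hs => ⟨hτ.trans hs.1.le, hs.2.trans hτ't⟩
  have hdisj : Disjoint (Icc 0 τ) (Ioc τ τ') := (Iic_disjoint_Ioc le_rfl).mono_left Icc_subset_Iic_self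
  have hsplit : ∀ {f : ℝ → ℝ} {B : ℝ}, IntegrableOn f (Icc 0 t) → (∀ s ∈ Icc 0 t, ‖f s‖ ≤ B) →
      |(∫ s in Icc 0 τ', f s) - ∫ s in Icc 0 τ, f s| ≤ B * (τ' - τ) := by
    intro f B hf hB
    rw [← Icc_union_Ioc_eq_Icc hτ hττ', setIntegral_union hdisj measurableSet_Ioc
      (hf.mono_set (Icc_subset_Icc_right (hττ'.trans hτ't))) (hf.mono_set hIoc), add_sub_cancel_left,
      ← Real.norm_eq_abs, ← Real.volume_real_Ioc_of_le hττ']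
    exact norm_setIntegral_le_of_norm_le_const measure_Ioc_lt_top fun s hs => hB s (hIoc hs)
  have h1 : |RhsA σ Φ φ A N z τ' - RhsA σ Φ φ A N z τ| ≤ 2 * CA * K * η₁ * e * (τ' - τ) :=
    hsplit hFi hFb
  have h2 : |KfunA σ Φ φ A N z τ' - KfunA σ Φ φ A N z τ| ≤ 58 * CA * K * η₁ * e * (τ' - τ) :=
    hsplit hGi hGb
  linarith

end EnvelopeA

open EnvelopeA in
/-- **Registered stub [EnvA] `stub_envelopeA` (THE LIPSCHITZ ENVELOPE OF THE VALUE; wave 1 of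
skeleton v18 of the line `hemisphere-affine-slaving`, crux stmt-AtomisticToContinuum-9518).** For
`σ > 0`, `K ≥ 0`, a dilute level `0 < η₁ ≤ η_Z` with `|Z(η) − 1| ≤ Kη` on `[0, η_Z]`, a component
bound `C_A ≥ 0` and an energy level `E₀ ≥ 0` there is `L ≥ 0` (`L = 60 C_A K η₁ E₀`) such that for
every admissible kernel family, flow family, `N`, GOOD initial datum `z` with `(N+1)⁻¹ E_kin(z) ≤ E₀`,
horizon `t > 0`, matrix weight `A` smooth on `[0, t]` with `|A_ab| ≤ C_A` on `[0, t] × 𝕋³`, along an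
orbit with no block denser than `η₁/σ³` on `[0, t]`: for `0 ≤ τ ≤ τ' ≤ t`,
`|RhsA(τ') − RhsA(τ)| + |KfunA(τ') − KfunA(τ)| ≤ L (τ' − τ)` (clamp `A` in time through `projIcc 0 t`,
`continuous_comp_projIcc`, then `lipschitz_of_continuous` with `(N+1)⁻¹ E_kin(z) ≤ E₀`). [folklore] -/
theorem stub_envelopeA : ∀ (σ K ηZ η₁ CA E₀ : ℝ), 0 < σ → 0 ≤ K → 0 < η₁ → η₁ ≤ ηZ → 0 ≤ CA → 0 ≤ E₀ → (∀ η : ℝ, 0 ≤ η → η ≤ ηZ → |Literature.MathematicalPhysics.KineticTheory.hsCompressibility η - 1| ≤ K * η) → ∃ L : ℝ, 0 ≤ L ∧ ∀ (γ C : ℝ) (φ : ℕ → T3 → ℝ), AdmissibleKernel γ C φ → ∀ (Φ : Flows σ) (N : ℕ) (z : Cfg N), z ∈ (Φ N).good → ((N : ℝ) + 1)⁻¹ * Literature.Analysis.FluidPDE.configEnergy z ≤ E₀ → ∀ (t : ℝ) (A : ℝ → T3 → Fin 3 → Fin 3 → ℝ), 0 < t → SmoothMatrixOn (Icc 0 t)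 A → (∀ s ∈ Icc 0 t, ∀ (x : T3) (a b : Fin 3), |A s x a b| ≤ CA) → (∀ s ∈ Icc 0 t, ∀ x : T3, rhoB φ N ((Φ N).flow s z) x * σ ^ 3 ≤ η₁) → ∀ τ τ' : ℝ, 0 ≤ τ → τ ≤ τ' → τ' ≤ t → |RhsA σ Φ φ A N z τ' - RhsA σ Φ φ A N z τ| + |KfunA σ Φ φ A N z τ' - KfunA σ Φ φ A N z τ| ≤ L * (τ' - τ) := by
  intro σ K ηZ η₁ CA E₀ hσ hK hη₁ hη₁Z hCA hE₀ hZ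
  refine ⟨60 * CA * K * η₁ * E₀, by positivity, ?_⟩
  intro γ C φ hadm Φ N z hz hEz t A ht hA hAb hdil τ τ' hτ hττ' hτ't
  have hφc : Continuous (φ N) := (hadm.1 N).continuous
  have hφ0 : ∀ y, 0 ≤ φ N y := hadm.2.1 N
  have hφ1 : ∫ y, φ N y = 1 := hadm.2.2.1 N
  -- the weight clamped in time: jointly continuous components, same bound, same values on `[0, t]`
  set Ac : ℝ → T3 → Fin 3 → Fin 3 → ℝ := fun s x => A (projIcc 0 t ht.le s) x with hAc_def
  have hAcc : ∀ a b, Continuous fun q : ℝ × T3 => Ac q.1 q.2 a b := fun a b =>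
    continuous_comp_projIcc ht (hA a b)
  have hAcb : ∀ s x a b, |Ac s x a b| ≤ CA := fun s x a b =>
    hAb _ (projIcc 0 t ht.le s).2 x a b
  have htr : ∀ {s}, s ∈ Icc 0 t → ∀ x, trW Ac s x = trW A s x := fun hs x => by
    simp only [trW, hAc_def, projIcc_of_mem ht.le hs]
  have hkin : ∀ {s}, s ∈ Icc 0 t → ∀ (w : Cfg N) (x : T3),
      kinWA Ac φ N s w x = kinWA A φ N s w x := fun hs w x => by
    simp only [kinWA, hAc_def, projIcc_of_mem ht.le hs]
  have hR : ∀ {r}, r ≤ t → RhsA σ Φ φ Ac N z r = RhsA σ Φ φ A N z r := fun hrt => by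
    unfold RhsA
    refine setIntegral_congr_fun measurableSet_Icc fun s hs => ?_
    simp only [htr ⟨hs.1, hs.2.trans hrt⟩]
  have hKq : ∀ {r}, r ≤ t → KfunA σ Φ φ Ac N z r = KfunA σ Φ φ A N z r := fun hrt => by
    unfold KfunA
    refine setIntegral_congr_fun measurableSet_Icc fun s hs => ?_
    simp only [hkin ⟨hs.1, hs.2.trans hrt⟩]
  have hcore := lipschitz_of_continuous hσ hK hη₁Z hZ Φ hφc hφ0 hφ1 hz hAcc hAcb hdil hτ hττ' hτ't
  rw [hR hτ't, hR (hττ'.trans hτ't), hKq hτ't, hKq (hττ'.trans hτ't)] at hcore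
  refine hcore.trans ?_
  have he : ((N + 1 : ℕ) : ℝ)⁻¹ * Literature.Analysis.FluidPDE.configEnergy z ≤ E₀ := by
    rw [Nat.cast_succ]
    exact hEz
  have hd : 0 ≤ τ' - τ := sub_nonneg.2 hττ'
  exact mul_le_mul_of_nonneg_right (mul_le_mul_of_nonneg_left he (by positivity)) hd

end

end Summit.AtomisticToContinuum.HydrodynamicLimit.Theorems.HemisphereAffineSlaving
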